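import Mathlib
import HarnessLib
import Literature.Geometry.DiscreteGeometry.KissingPatterns

/-!
# FrustratedLawDichotomy · `TexturedLawTransfer` (stmt-AtomisticToContinuum-27625) · registered stub `stub_textureUnpacking`
(LINE «truncated-bs», decomp-a2c lens 2 «structural dichotomy», generation 13)

**Texture is inherited by local limits (deterministic recentring).**  If a counting configuration `μ` is two-way
`ε`-matched ABOUT ITS ROOT `0`, at every radius `R` and tolerance `ε`, by `7/10`-separated TCP-textured balls
`TexBall N w j R R₇ R₈ R₉` recentred at the particle `j`, then `Appr μ R₇ R₈ R₉`: the same matching holds about EVERY atom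
`q` of `μ`.  Proof: apply the hypothesis at radius `|R| + ‖q‖ + ε` and tolerance `ε/2`; the atom `q` is matched by some
particle `k_q` with `|w k_q − w j − q| ≤ ε/2`; recentre at `k_q` — matching errors add up to `ε`, and every clause of
`TexBall` is a property of a particle guarded only by its distance to the centre, so the `R`-ball about `k_q` inherits it
from the `(|R| + ‖q‖ + ε)`-ball about `j` (triangle inequality).  No measure theory is used.
-/

noncomputable section

namespace Summit.AtomisticToContinuum.Crystallization.Theorems.FrustratedLawDichotomyTextureUnpacking

/-- Recentring of a two-way matching: errors add. [folklore] -/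
theorem dist_recentre (a b c p q : EuclideanSpace ℝ (Fin 3)) {ε : ℝ}
    (h₁ : dist (a - c) p ≤ ε / 2) (h₂ : dist (b - c) q ≤ ε / 2) : dist (a - b) (p - q) ≤ ε := by
  rw [dist_eq_norm] at h₁ h₂ ⊢
  have e : a - b - (p - q) = (a - c - p) - (b - c - q) := by abel
  rw [e]
  calc ‖(a - c - p) - (b - c - q)‖ ≤ ‖a - c - p‖ + ‖b - c - q‖ := norm_sub_le _ _
    _ ≤ ε := by linarith

/-- `‖p‖ ≤ dist p q + ‖q‖`. [folklore] -/
theorem norm_le_dist_add_norm (p q : EuclideanSpace ℝ (Fin 3)) : ‖p‖ ≤ dist p q + ‖q‖ := by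
  calc ‖p‖ = ‖(p - q) + q‖ := by rw [sub_add_cancel]
    _ ≤ ‖p - q‖ + ‖q‖ := norm_add_le _ _
    _ = dist p q + ‖q‖ := by rw [dist_eq_norm]

/-- **Registered stub `stub_textureUnpacking` of LINE «truncated-bs» on `FrustratedLawDichotomy.TexturedLawTransfer`
(stmt-AtomisticToContinuum-27625), BY NAME AND SIGNATURE.** [folklore] -/
theorem stub_textureUnpacking :
    ∀ μ : MeasureTheory.Measure (EuclideanSpace ℝ (Fin 3)), ∀ R₇ R₈ R₉ : ℝ, let Gy : ℝ → (N : ℕ) → (Fin N → EuclideanSpace ℝ (Fin 3)) → Fin N → Prop := fun η N y j => let d : ℝ := sInf ((fun z => dist z (y (j : Fin N))) '' (Set.range (y) \ {(y (j : Fin N))})); let T : Set (EuclideanSpace ℝ (Fin 3)) := {z : EuclideanSpace ℝ (Fin 3) | z ∈ Set.range (y) ∧ z ≠ (y (j : Fin N)) ∧ dist z (y (j : Fin N)) < 13 / 10 * d}; ∃ A : EuclideanSpace ℝ (Fin 3) →ₗᵢ[ℝ] EuclideanSpace ℝ (Fin 3), (∃ e : ↥T ≃ ↥Literature.Geometry.DiscreteGeometry.fccKissingPattern,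 ∀ t : ↥T, dist (d⁻¹ • ((t : EuclideanSpace ℝ (Fin 3)) - (y (j : Fin N)))) (A ((e t : ↥Literature.Geometry.DiscreteGeometry.fccKissingPattern) : EuclideanSpace ℝ (Fin 3))) ≤ η) ∨ (∃ e : ↥T ≃ ↥Literature.Geometry.DiscreteGeometry.hcpKissingPattern, ∀ t : ↥T, dist (d⁻¹ • ((t : EuclideanSpace ℝ (Fin 3)) - (y (j : Fin N)))) (A ((e t : ↥Literature.Geometry.DiscreteGeometry.hcpKissingPattern) : EuclideanSpace ℝ (Fin 3))) ≤ η); let TexBall : (N : ℕ) → (Fin N → EuclideanSpace ℝ (Fin 3)) → Fin N → ℝ → ℝ → ℝ → ℝ → Prop := fun N y i R R₇ R₈ R₉ => (∀ a b : Fin N, a ≠ b → (7 : ℝ) / 10 ≤ dist (y a) (y b)) ∧ (∀ j : Fin N, dist (y j) (y i) ≤ R → ¬ Gy (1 / 20) N (y) j) ∧ (∀ j : Fin N, dist (y j) (y i) ≤ R → ¬ ((∀ j' : Fin N, dist (y j') (y j) ≤ R₇ → ¬ Gy (1 / 20) N (y) j') ∧ (∀ z : EuclideanSpace ℝ (Fin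 3), dist z (y j) ≤ R₇ → ∃ k : Fin N, dist z (y k) ≤ 1) ∧ (∀ j' : Fin N, dist (y j') (y j) ≤ R₇ → (let d : ℝ := sInf ((fun z => dist z (y j')) '' (Set.range (y) \ {(y j')})); ∀ k : Fin N, y k ≠ y j' → dist (y k) (y j') < 27 / 20 * d → 5 ≤ Nat.card {m : Fin N // y m ≠ y j' ∧ dist (y m) (y j') < 27 / 20 * d ∧ y m ≠ y k ∧ dist (y m) (y k) < 27 / 20 * d})))) ∧ (∀ j : Fin N, dist (y j) (y i) ≤ R → ∃ k : Fin N, dist (y k) (y j) ≤ R₈ ∧ Gy (1 / 8) N (y) k) ∧ (∀ j : Fin N, dist (y j) (y i) ≤ R → ¬ ((∀ j' : Fin N, dist (y j') (y j) ≤ R₉ → ¬ Gy (1 / 20) N (y) j') ∧ (Nat.card {j' : Fin N // dist (y j') (y j) ≤ R₉ ∧ ¬ Gy (1 / 8) N (y) j'} : ℝ) ≤ 1 / 2 * (Nat.card {j' : Fin N // dist (y j') (y j) ≤ R₉} : ℝ) ∧ (∀ j' : Fin N, dist (y j') (y j) ≤ R₉ → ¬ Gy (1 / 8) N (y) j' →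 ¬ (let d : ℝ := sInf ((fun z => dist z (y j')) '' (Set.range (y) \ {(y j')})); ∀ k : Fin N, y k ≠ y j' → dist (y k) (y j') < 27 / 20 * d → 5 ≤ Nat.card {m : Fin N // y m ≠ y j' ∧ dist (y m) (y j') < 27 / 20 * d ∧ y m ≠ y k ∧ dist (y m) (y k) < 27 / 20 * d})))); let Appr : MeasureTheory.Measure (EuclideanSpace ℝ (Fin 3)) → ℝ → ℝ → ℝ → Prop := fun μ R₇ R₈ R₉ => ∀ q : EuclideanSpace ℝ (Fin 3), μ {q} ≠ 0 → ∀ R ε : ℝ, 0 < ε → ∃ (N : ℕ) (y : Fin N → EuclideanSpace ℝ (Fin 3)) (i : Fin N), TexBall N y i R R₇ R₈ R₉ ∧ (∀ p : EuclideanSpace ℝ (Fin 3), μ {p} ≠ 0 → dist p q ≤ R → ∃ k : Fin N, dist (y k - y i) (p - q) ≤ ε) ∧ (∀ k : Fin N, dist (y k) (y i) ≤ R → ∃ p : EuclideanSpace ℝ (Fin 3), μ {p} ≠ 0 ∧ dist (y k - y i) (p - q) ≤ ε); (∀ R ε : ℝ, 0 < ε → ∃ (N : ℕ) (w : Fin N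 → EuclideanSpace ℝ (Fin 3)) (j : Fin N), TexBall N w j R R₇ R₈ R₉ ∧ (∀ p : EuclideanSpace ℝ (Fin 3), μ {p} ≠ 0 → ‖p‖ ≤ R → ∃ k : Fin N, dist (w k - w j) p ≤ ε) ∧ (∀ k : Fin N, dist (w k) (w j) ≤ R → ∃ p : EuclideanSpace ℝ (Fin 3), μ {p} ≠ 0 ∧ dist (w k - w j) p ≤ ε)) → Appr μ R₇ R₈ R₉ := by
  intro μ R₇ R₈ R₉
  dsimp only
  intro hloc q hq R ε hε
  obtain ⟨N, w, j, hT, hM1, hM2⟩ := hloc (|R| + ‖q‖ + ε) (ε / 2) (by positivity)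
  have hR : R ≤ |R| := le_abs_self R
  have hqR : ‖q‖ ≤ |R| + ‖q‖ + ε := by
    have := abs_nonneg R
    linarith
  obtain ⟨kq, hkq⟩ := hM1 q hq hqR
  have hc : dist (w kq) (w j) ≤ ‖q‖ + ε / 2 := by
    have h1 := norm_le_dist_add_norm (w kq - w j) q
    rw [dist_eq_norm]
    linarith
  have hwithin : ∀ k : Fin N, dist (w k) (w kq) ≤ R → dist (w k) (w j) ≤ |R| + ‖q‖ + ε := fun k hk => by
    have := dist_triangle (w k) (w kq) (w j)
    linarith
  refine ⟨N, w, kq, ?_, ?_, ?_⟩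
  · obtain ⟨hsep, h2, h3, h4, h5⟩ := hT
    exact ⟨hsep, fun j' hj' => h2 j' (hwithin j' hj'), fun j' hj' => h3 j' (hwithin j' hj'),
      fun j' hj' => h4 j' (hwithin j' hj'), fun j' hj' => h5 j' (hwithin j' hj')⟩
  · intro p hp hpq
    have hpR : ‖p‖ ≤ |R| + ‖q‖ + ε := by
      have h1 := norm_le_dist_add_norm p q
      linarith
    obtain ⟨k, hk⟩ := hM1 p hp hpR
    exact ⟨k, dist_recentre _ _ _ _ _ hk hkq⟩
  · intro k hk
    obtain ⟨p, hp, hkp⟩ := hM2 k (hwithin k hk)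
    exact ⟨p, hp, dist_recentre _ _ _ _ _ hkp hkq⟩

end Summit.AtomisticToContinuum.Crystallization.Theorems.FrustratedLawDichotomyTextureUnpacking

end
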